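/-
# Solo-blind programme on Kontsevich–Zagier, s6 part T3a: the dilogarithm cell at an algebraic cut

S5 ran the reflection of the simplex `Λ₂` at the dyadic point `½`.  Here the cut point is an
arbitrary real algebraic number `x ∈ (0,1)`, packaged as a `Cut`, and the **Euler reflection** of
the dilogarithm becomes a chain of KZ moves, uniformly in `x`.  This file runs the first two:

* the dilogarithm cell `D(x) = [0 < t₁ < t₀ < x, dt/(t₀(1−t₁))]` (`dilogCut`, period `Li₂(x)`),
  the upper triangle `U(x) = [x < t₁ < t₀ < 1]` and the rectangle `P(x) = (x,1) × (0,x)`;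
* move (1a): `Λ₂ = D(x) ⊔ U(x) ⊔ P(x)` (`simplexTwo_dissect_cut`);
* move (2): the reflection `ρ(t₀,t₁) = (1−t₁,1−t₀)` maps `D(1−x)` onto `U(x)` and fixes the form
  (`dilogCut_symm_equiv_upperCut`);
* the only new point over s5: the cut sets are `ℚ`-semialgebraic because the cut point is
  algebraic (`isSemialgebraic_sep_apply_lt`, from the Literature fact that algebraic constants
  are semialgebraic functions).

The affine move `P(x) ≡ ℓ(1/x) × ℓ(1/(1−x))` and Euler's identity
`[Λ₂] = [D(x)] + [D(1−x)] + ℓ(1/x)ℓ(1/(1−x))` follow in `SoloBlindDilogEuler`.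
-/
import Summits.KontsevichZagierPeriods.KontsevichZagierPeriods.Theorems.SoloBlindDilog

noncomputable section

open MeasureTheory Set MvPolynomial
open Literature.NumberTheory.Transcendental
open Literature.NumberTheory.Transcendental.KZ
open Literature.NumberTheory.Transcendental.KZ.IntegralRep
open Literature.ModelTheory.ExponentialFields (IsSemialgebraic isSemialgebraic_setOf_eval_pos)

namespace Summit.KontsevichZagierPeriods.KontsevichZagierPeriods.Theorems

namespace SoloBlind

/-! ## Algebraic cut points -/

/-- A real algebraic cut point `x ∈ (0,1)`. -/
@[ext] structure Cut where
  /-- the cut point -/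
  x : ℝ
  /-- it is algebraic -/
  alg : IsAlgebraic ℚ x
  /-- it is positive -/
  pos : 0 < x
  /-- it is below `1` -/
  lt_one : x < 1

namespace Cut

variable (c : Cut)

/-- The reflected cut `1 − x`. -/
def symm : Cut := ⟨1 - c.x, isAlgebraic_one.sub c.alg, sub_pos.2 c.lt_one, by linarith [c.pos]⟩

/-- `(c.symm).x = 1 − x`. -/
@[simp] theorem symm_x : c.symm.x = 1 - c.x := rfl

/-- `1/x` is algebraic. -/
theorem alg_inv : IsAlgebraic ℚ c.x⁻¹ := c.alg.inv

/-- `1 < 1/x`. -/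
theorem one_lt_inv : 1 < c.x⁻¹ := (one_lt_inv₀ c.pos).2 c.lt_one

/-- `1 − x` is positive. -/
theorem symm_pos : 0 < 1 - c.x := sub_pos.2 c.lt_one

end Cut

/-- A semialgebraic set cut by a strict inequality between two semialgebraic functions is
semialgebraic. -/
theorem isSemialgebraic_sep_lt {n : ℕ} {S : Set (Fin n → ℝ)} {f g : (Fin n → ℝ) → ℝ}
    (hf : IsSemialgebraicFunOn ℚ S f) (hg : IsSemialgebraicFunOn ℚ S g) :
    IsSemialgebraic ℚ {t | t ∈ S ∧ f t < g t} := by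
  convert (IsSemialgebraicFunOn.sub_holds hf hg).isSemialgebraic_sep_neg using 2 with t
  simp [sub_neg]

/-- Cutting a semialgebraic set by `t i < a` for an algebraic constant `a`. -/
theorem isSemialgebraic_sep_apply_lt {n : ℕ} {S : Set (Fin n → ℝ)} (hS : IsSemialgebraic ℚ S)
    (i : Fin n) {a : ℝ} (ha : IsAlgebraic ℚ a) : IsSemialgebraic ℚ {t | t ∈ S ∧ t i < a} := by
  simpa using isSemialgebraic_sep_lt (isSemialgebraicFunOn_aeval hS (X i))
    (isSemialgebraicFunOn_const_of_isAlgebraic hS ha)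

/-- Cutting a semialgebraic set by `a < t i` for an algebraic constant `a`. -/
theorem isSemialgebraic_sep_lt_apply {n : ℕ} {S : Set (Fin n → ℝ)} (hS : IsSemialgebraic ℚ S)
    (i : Fin n) {a : ℝ} (ha : IsAlgebraic ℚ a) : IsSemialgebraic ℚ {t | t ∈ S ∧ a < t i} := by
  simpa using isSemialgebraic_sep_lt (isSemialgebraicFunOn_const_of_isAlgebraic hS ha)
    (isSemialgebraicFunOn_aeval hS (X i))

variable (c : Cut)

/-! ## The three pieces of `Λ₂` cut at `x` -/

/-- The dilogarithm triangle `D(x) = {0 < t₁ < t₀ < x}`. -/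
def cutDom : Set (Fin 2 → ℝ) := {t | 0 < t 1 ∧ t 1 < t 0 ∧ t 0 < c.x}

/-- The upper triangle `U(x) = {x < t₁ < t₀ < 1}`. -/
def cutUpper : Set (Fin 2 → ℝ) := {t | c.x < t 1 ∧ t 1 < t 0 ∧ t 0 < 1}

/-- The rectangle `P(x) = {x < t₀ < 1, 0 < t₁ < x}`. -/
def cutRect : Set (Fin 2 → ℝ) := {t | 0 < t 1 ∧ t 1 < c.x ∧ c.x < t 0 ∧ t 0 < 1}

/-- The open triangle `{0 < t₁ < t₀}` is semialgebraic. -/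
theorem isSemialgebraic_wedge : IsSemialgebraic ℚ {t : Fin 2 → ℝ | 0 < t 1 ∧ t 1 < t 0} := by
  have h : {t : Fin 2 → ℝ | 0 < t 1 ∧ t 1 < t 0} =
      {t | 0 < aeval t (X 1 : MvPolynomial (Fin 2) ℚ)} ∩
        {t | 0 < aeval t (X 0 - X 1 : MvPolynomial (Fin 2) ℚ)} := by
    ext t; simp [sub_pos]
  rw [h]
  exact (isSemialgebraic_setOf_eval_pos _).inter (isSemialgebraic_setOf_eval_pos _)

/-- `D(x)` is semialgebraic (the cut point is algebraic). -/
theorem isSemialgebraic_cutDom : IsSemialgebraic ℚ (cutDom c) := by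
  convert isSemialgebraic_sep_apply_lt isSemialgebraic_wedge 0 c.alg using 1
  ext t; simp [cutDom, and_assoc]

/-- `U(x)` is semialgebraic. -/
theorem isSemialgebraic_cutUpper : IsSemialgebraic ℚ (cutUpper c) := by
  have h : {t : Fin 2 → ℝ | t 1 < t 0 ∧ t 0 < 1} =
      {t | 0 < aeval t (X 0 - X 1 : MvPolynomial (Fin 2) ℚ)} ∩
        {t | 0 < aeval t (1 - X 0 : MvPolynomial (Fin 2) ℚ)} := by
    ext t; simp [sub_pos]
  have h1 : IsSemialgebraic ℚ {t : Fin 2 → ℝ | t 1 < t 0 ∧ t 0 < 1} := by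
    rw [h]; exact (isSemialgebraic_setOf_eval_pos _).inter (isSemialgebraic_setOf_eval_pos _)
  convert isSemialgebraic_sep_lt_apply h1 1 c.alg using 1
  ext t; simp only [cutUpper, mem_setOf_eq]; tauto

/-- `P(x)` is semialgebraic. -/
theorem isSemialgebraic_cutRect : IsSemialgebraic ℚ (cutRect c) := by
  have h : {t : Fin 2 → ℝ | 0 < t 1 ∧ t 0 < 1} = {t | 0 < aeval t (X 1 : MvPolynomial (Fin 2) ℚ)} ∩
      {t | 0 < aeval t (1 - X 0 : MvPolynomial (Fin 2) ℚ)} := by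
    ext t; simp [sub_pos]
  have h1 : IsSemialgebraic ℚ {t : Fin 2 → ℝ | 0 < t 1 ∧ t 0 < 1} := by
    rw [h]; exact (isSemialgebraic_setOf_eval_pos _).inter (isSemialgebraic_setOf_eval_pos _)
  have h2 := isSemialgebraic_sep_apply_lt h1 1 c.alg
  convert isSemialgebraic_sep_lt_apply h2 0 c.alg using 1
  ext t; simp only [cutRect, mem_setOf_eq]; tauto

/-- `D(x) ⊆ Λ₂`. -/
theorem cutDom_subset : cutDom c ⊆ simplexTwo.domain := fun t ht => by
  rw [mem_simplexTwo_domain]; simp only [cutDom, mem_setOf_eq] at ht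
  exact ⟨ht.1, ht.2.1, ht.2.2.trans c.lt_one⟩

/-- `U(x) ⊆ Λ₂`. -/
theorem cutUpper_subset : cutUpper c ⊆ simplexTwo.domain := fun t ht => by
  rw [mem_simplexTwo_domain]; simp only [cutUpper, mem_setOf_eq] at ht
  exact ⟨c.pos.trans ht.1, ht.2.1, ht.2.2⟩

/-- `P(x) ⊆ Λ₂`. -/
theorem cutRect_subset : cutRect c ⊆ simplexTwo.domain := fun t ht => by
  rw [mem_simplexTwo_domain]; simp only [cutRect, mem_setOf_eq] at ht
  exact ⟨ht.1, ht.2.1.trans ht.2.2.1, ht.2.2.2⟩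

/-- **The dilogarithm cell** `D(x) = [0 < t₁ < t₀ < x, dt/(t₀(1−t₁))]`, period `Li₂(x)`. -/
def dilogCut : IntegralRep 2 :=
  ratRep (cutDom c) dilogFun 1 (X 0 * (1 - X 1)) (isSemialgebraic_cutDom c)
    (fun t ht => by simpa using dilogDen_ne_zero (cutDom_subset c ht))
    (fun t _ => by simp [dilogFun])
    (integrableOn_dilogFun (cutDom_subset c)
      (IsSemialgebraic.measurableSet_holds (isSemialgebraic_cutDom c)))

/-- The upper triangle `U(x)` with the dilogarithm form. -/
def upperCut : IntegralRep 2 :=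
  ratRep (cutUpper c) dilogFun 1 (X 0 * (1 - X 1)) (isSemialgebraic_cutUpper c)
    (fun t ht => by simpa using dilogDen_ne_zero (cutUpper_subset c ht))
    (fun t _ => by simp [dilogFun])
    (integrableOn_dilogFun (cutUpper_subset c)
      (IsSemialgebraic.measurableSet_holds (isSemialgebraic_cutUpper c)))

/-- The rectangle `P(x)` with the dilogarithm form. -/
def rectCut : IntegralRep 2 :=
  ratRep (cutRect c) dilogFun 1 (X 0 * (1 - X 1)) (isSemialgebraic_cutRect c)
    (fun t ht => by simpa using dilogDen_ne_zero (cutRect_subset c ht))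
    (fun t _ => by simp [dilogFun])
    (integrableOn_dilogFun (cutRect_subset c)
      (IsSemialgebraic.measurableSet_holds (isSemialgebraic_cutRect c)))

/-- `D(x)` is a rational representation. -/
theorem dilogCut_isRational : (dilogCut c).IsRational := isRational_ratRep ..

/-! ## Move (1a): `Λ₂ = D(x) ⊔ U(x) ⊔ P(x)` -/

/-- **Dissection move.** `[Λ₂] − [D(x)] − [U(x)] − [P(x)]` is a relation. -/
theorem simplexTwo_dissect_cut :
    of simplexTwo - of (dilogCut c) - of (upperCut c) - of (rectCut c) ∈ relations := by
  let R : Fin 3 → IntegralRep 2 := ![dilogCut c, upperCut c, rectCut c]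
  have hR : ∀ i, (R i).domain ⊆ simplexTwo.domain ∧ (R i).integrand = dilogFun := by
    intro i; fin_cases i
    exacts [⟨cutDom_subset c, rfl⟩, ⟨cutUpper_subset c, rfl⟩, ⟨cutRect_subset c, rfl⟩]
  have h := of_sub_sum_of_mem_relations (Finset.univ : Finset (Fin 3)) simplexTwo R
    (fun i _ => measure_mono_null (fun t ht => absurd ((hR i).1 ht.1) ht.2) measure_empty)
    (fun i _ t ht => by rw [(hR i).2]; exact (simplexTwo_integrand_eq t).symm) ?_ ?_
  · have e : ∑ i : Fin 3, of (R i) = of (dilogCut c) + of (upperCut c) + of (rectCut c) := by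
      rw [Fin.sum_univ_three]; rfl
    rw [e] at h; convert h using 1; abel
  · have hc : ∀ i : Fin 2, volume {t : Fin 2 → ℝ | t i = c.x} = 0 := fun i => by
      rw [volume_pi]; exact Measure.pi_hyperplane (fun _ : Fin 2 => (volume : Measure ℝ)) i _
    refine measure_mono_null (fun t ht => ?_) (measure_union_null (hc 0) (hc 1))
    obtain ⟨ht, hn⟩ := ht
    rw [mem_simplexTwo_domain] at ht
    simp only [mem_iUnion, Finset.mem_univ, exists_true_left, not_exists] at hn
    have h0 : t ∉ cutDom c := hn 0
    have h1 : t ∉ cutUpper c := hn 1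
    have h2 : t ∉ cutRect c := hn 2
    simp only [cutDom, cutUpper, cutRect, mem_setOf_eq, not_and, not_lt] at h0 h1 h2
    by_contra hne
    simp only [mem_union, mem_setOf_eq, not_or] at hne
    rcases lt_or_gt_of_ne hne.1 with ha | ha
    · rcases lt_or_gt_of_ne hne.2 with hb | hb
      · exact absurd (h0 ht.1 ht.2.1) (not_le.2 ha)
      · linarith [ht.2.1]
    · rcases lt_or_gt_of_ne hne.2 with hb | hb
      · exact absurd (h2 ht.1 hb ha) (not_le.2 ht.2.2)
      · exact absurd (h1 hb ht.2.1) (not_le.2 ht.2.2)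
  · intro i _ j _ hij
    have key : ∀ i j, i < j → volume ((R i).domain ∩ (R j).domain) = 0 := by
      intro i j hlt
      rw [show (R i).domain ∩ (R j).domain = ∅ from ?_, measure_empty]
      ext t
      simp only [mem_inter_iff, mem_empty_iff_false, iff_false, not_and]
      intro hi hj
      fin_cases i <;> fin_cases j <;> simp at hlt
      · change t ∈ cutDom c at hi; change t ∈ cutUpper c at hj
        simp only [cutDom, cutUpper, mem_setOf_eq] at hi hj; linarith [hi.2.1]
      · change t ∈ cutDom c at hi; change t ∈ cutRect c at hj
        simp only [cutDom, cutRect, mem_setOf_eq] at hi hj; linarith [hi.2.2]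
      · change t ∈ cutUpper c at hi; change t ∈ cutRect c at hj
        simp only [cutUpper, cutRect, mem_setOf_eq] at hi hj; linarith [hi.1]
    rcases lt_or_gt_of_ne hij with hlt | hlt
    · exact key i j hlt
    · rw [inter_comm]; exact key j i hlt

/-! ## Move (2): the reflection maps `D(1−x)` onto `U(x)` -/

/-- The reflection maps `D(1−x)` onto `U(x)`. -/
theorem image_reflChart_cutDom_symm : reflChart '' cutDom c.symm = cutUpper c := by
  ext u
  simp only [mem_image, cutDom, cutUpper, Cut.symm_x, mem_setOf_eq]
  constructor
  · rintro ⟨t, ⟨h1, h2, h3⟩, rfl⟩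
    simp only [reflChart, Matrix.cons_val_zero, Matrix.cons_val_one]
    exact ⟨by linarith, by linarith, by linarith⟩
  · rintro ⟨h1, h2, h3⟩
    refine ⟨![1 - u 1, 1 - u 0], ⟨?_, ?_, ?_⟩, ?_⟩
    · show 0 < 1 - u 0
      linarith
    · show 1 - u 0 < 1 - u 1
      linarith
    · show 1 - u 1 < 1 - c.x
      linarith
    · funext i
      fin_cases i
      · show 1 - (1 - u 0) = u 0
        ring
      · show 1 - (1 - u 1) = u 1
        ring

/-- `ρ` is a `ℚ`-polynomial map on `D(1−x)`. -/
theorem isSemialgebraicMapOn_reflChart_cut : IsSemialgebraicMapOn ℚ (cutDom c.symm) reflChart := by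
  refine IsSemialgebraicMapOn.of_forall (isSemialgebraic_cutDom _) fun i => ?_
  fin_cases i
  · exact (isSemialgebraicFunOn_aeval (isSemialgebraic_cutDom _) (1 - X 1)).congr
      fun t _ => by simp [reflChart]
  · exact (isSemialgebraicFunOn_aeval (isSemialgebraic_cutDom _) (1 - X 0)).congr
      fun t _ => by simp [reflChart]

/-- **Reflection move at the cut.** `D(1−x) ≡ U(x)`. -/
theorem dilogCut_symm_equiv_upperCut : Equivalent (dilogCut c.symm) (upperCut c) :=
  equivalent_of_chart (isSemialgebraicMapOn_reflChart_cut c) (fun t _ => hasFDerivAt_reflChart t)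
    injective_reflChart.injOn (image_reflChart_cutDom_symm c) (fun _ _ => abs_det_reflDeriv)
    (f := dilogFun) (g := dilogFun)
    (fun t _ => by
      simp only [dilogFun, reflChart, Matrix.cons_val_zero, Matrix.cons_val_one]
      ring)
    rfl (fun _ _ => rfl) rfl fun _ _ => rfl

end SoloBlind

end Summit.KontsevichZagierPeriods.KontsevichZagierPeriods.Theorems
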